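import Summits.CriticalPhenomena.SAWScalingLimit.Theorems.BoundaryClosureNegative_Instance

/-!
# Negative lemma for the crux `SAWDevelopingMap.ObservableToSLE` (stmt-CriticalPhenomena-10472), line
`floor-ratio-restriction-bootstrap` — the root-rows clause of the floor-ratio limit is load-bearing.
Part 2 (continuum side): the re-marked half-disc `(HD; r, 1/4)`, flatness of `HD` at real points at
radius `1/4`, the logarithm `L_r` of `Φ_r'` at floor points (it is real there, with a boundary value),
and the endgame at a floor point (`endgame_real`: the two predicted ratio limits are incompatible).

Support for `FloorRatioLimitRootPinning.lean` (refuter, drefute, 2026-08-16); built on the landed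
corridor modules `BoundaryClosureNegative_*`.  Everything proved. [folklore]
-/

noncomputable section

open Set Filter Topology Complex MeasureTheory Metric
open scoped BigOperators NNReal ENNReal Classical
open Literature.Probability.RandomPlanarGeometry
open UpperHalfPlane (upperHalfPlaneSet)
open Literature.Probability.LatticeModels Literature.Probability.RandomPlanarGeometry.SAW

namespace Summit.CriticalPhenomena.SAWScalingLimit.Theorems.ObservableToSLE.Negative

open Summit.CriticalPhenomena.SAWScalingLimit.Theorems.BoundaryClosure.Negative

/-! ## §2 The re-marked half-disc `(HD; r, 1/4)` and flatness at radius `1/4` -/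

/-- **The half-disc with marked points `r ∈ (1/4, 1)` and `1/4`.** [folklore] -/
def halfDiscDomainQ (r : ℝ) (hr : 1 / 4 < r ∧ r < 1) : DobrushinDomain where
  toJordanDomain := halfDiscJordan
  mark := ![(3 - r) / 4, 11 / 16]
  strictMono_mark := by
    refine Fin.strictMono_iff_lt_succ.2 fun k => ?_
    fin_cases k
    simp; linarith [hr.1]
  mark_mem k := by
    fin_cases k
    · simp; constructor <;> linarith [hr.1, hr.2]
    · simp; norm_num

/-- The first marked point is `r`. [folklore] -/
theorem pt_zero_halfDiscDomainQ (r : ℝ) (hr : 1 / 4 < r ∧ r < 1) :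
    (halfDiscDomainQ r hr).pt 0 = (r : ℂ) := by
  show bdry ((3 - r) / 4) = r
  rw [bdry_eq_of_mem ⟨by linarith [hr.2], by linarith [hr.1]⟩, bdryFun_of_gt (by linarith [hr.2])]
  push_cast; ring

/-- The second marked point is `1/4`. [folklore] -/
theorem pt_one_halfDiscDomainQ (r : ℝ) (hr : 1 / 4 < r ∧ r < 1) :
    (halfDiscDomainQ r hr).pt 1 = ((1 / 4 : ℝ) : ℂ) := by
  show bdry (11 / 16) = ((1 / 4 : ℝ) : ℂ)
  rw [bdry_eq_of_mem ⟨by norm_num, by norm_num⟩, bdryFun_of_gt (by norm_num)]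
  norm_num

/-- Flatness at `0`, radius `1/4`. [folklore] -/
theorem HD_inter_ball_quarter :
    HD ∩ ball (0 : ℂ) (1 / 4) = {z : ℂ | (0 : ℂ).im < z.im} ∩ ball (0 : ℂ) (1 / 4) := by
  ext z
  simp only [HD, mem_inter_iff, mem_setOf_eq, Metric.mem_ball, dist_zero_right, Complex.zero_im]
  constructor
  · rintro ⟨⟨-, h⟩, h'⟩; exact ⟨h, h'⟩
  · rintro ⟨h, h'⟩; exact ⟨⟨by linarith, h⟩, h'⟩

/-- The ball of radius `1/4` about `1/4` lies in the ball of radius `1/2` about `0`. [folklore] -/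
theorem ball_quarter_subset : ball ((1 / 4 : ℝ) : ℂ) (1 / 4) ⊆ ball (0 : ℂ) (1 / 2) := by
  intro z hz
  rw [Metric.mem_ball, dist_eq_norm] at hz
  rw [Metric.mem_ball, dist_zero_right]
  have hc : ‖((1 / 4 : ℝ) : ℂ)‖ = 1 / 4 := by
    rw [Complex.norm_real, Real.norm_of_nonneg (by norm_num)]
  calc ‖z‖ = ‖(z - ((1 / 4 : ℝ) : ℂ)) + ((1 / 4 : ℝ) : ℂ)‖ := by rw [sub_add_cancel]
    _ ≤ ‖z - ((1 / 4 : ℝ) : ℂ)‖ + ‖((1 / 4 : ℝ) : ℂ)‖ := norm_add_le _ _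
    _ < 1 / 4 + 1 / 4 := by rw [hc]; linarith
    _ = 1 / 2 := by norm_num

/-- **Flatness of the half-disc at a real point `c` with `|c| ≤ 3/4`, radius `1/4`.** [folklore] -/
theorem HD_inter_ball_real {c : ℝ} (hc : |c| ≤ 3 / 4) :
    HD ∩ ball ((c : ℝ) : ℂ) (1 / 4) = {z : ℂ | ((c : ℝ) : ℂ).im < z.im} ∩ ball ((c : ℝ) : ℂ) (1 / 4) := by
  ext z
  simp only [HD, mem_inter_iff, mem_setOf_eq, Complex.ofReal_im]
  constructor
  · rintro ⟨⟨-, h⟩, h'⟩; exact ⟨h, h'⟩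
  · rintro ⟨h, h'⟩
    refine ⟨⟨?_, h⟩, h'⟩
    have hz : ‖z - (c : ℂ)‖ < 1 / 4 := by rw [← dist_eq_norm]; exact h'
    have hcn : ‖(c : ℂ)‖ = |c| := by rw [Complex.norm_real, Real.norm_eq_abs]
    calc ‖z‖ = ‖(z - (c : ℂ)) + (c : ℂ)‖ := by rw [sub_add_cancel]
      _ ≤ ‖z - (c : ℂ)‖ + ‖(c : ℂ)‖ := norm_add_le _ _
      _ < 1 / 4 + 3 / 4 := by rw [hcn]; linarith
      _ = 1 := by norm_num

/-! ## §3 The logarithm `L_r` at real points of the floor -/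

/-- The real logarithm of `Φ_r'` on the floor segment `(-1, r)`. [folklore] -/
def lreal (r x : ℝ) : ℝ :=
  Real.log ((1 - r) ^ 2 * r) + Real.log (1 - x ^ 2) - 2 * Real.log (r - x) - 2 * Real.log (1 - r * x)

/-- On the floor segment `(-1, r)` the complex logarithm `L_r` is the real one. [folklore] -/
theorem Lfun_ofReal {r x : ℝ} (hr : 0 < r ∧ r < 1) (hx : -1 < x ∧ x < r) :
    Lfun r (x : ℂ) = (lreal r x : ℂ) := by
  have h1 : 0 ≤ (1 - r) ^ 2 * r := mul_nonneg (sq_nonneg _) hr.1.le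
  have h2 : 0 ≤ 1 - x ^ 2 := by nlinarith [hx.1, hx.2, hr.2]
  have h3 : 0 ≤ r - x := by linarith [hx.2]
  have h4 : 0 ≤ 1 - r * x := by nlinarith [hx.1, hx.2, hr.1, hr.2]
  unfold Lfun lreal
  rw [show (1 : ℂ) - (x : ℂ) ^ 2 = ((1 - x ^ 2 : ℝ) : ℂ) by push_cast; ring,
    show (r : ℂ) - (x : ℂ) = ((r - x : ℝ) : ℂ) by push_cast; ring,
    show (1 : ℂ) - (r : ℂ) * (x : ℂ) = ((1 - r * x : ℝ) : ℂ) by push_cast; ring,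
    ← Complex.ofReal_log h1, ← Complex.ofReal_log h2, ← Complex.ofReal_log h3,
    ← Complex.ofReal_log h4]
  push_cast; ring

/-- `L_r 0` is real. [folklore] -/
theorem Lfun_zero_ofReal {r : ℝ} (hr : 0 < r ∧ r < 1) : Lfun r 0 = (lreal r 0 : ℂ) := by
  rw [← Complex.ofReal_zero, Lfun_ofReal hr ⟨by norm_num, hr.1⟩]

/-- The three arguments of `L_r` avoid the negative real axis at a floor point `x ∈ (-1, r)`.
[folklore] -/
theorem slit_ofReal {r x : ℝ} (hr : 0 < r ∧ r < 1) (hx : -1 < x ∧ x < r) :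
    1 - (x : ℂ) ^ 2 ∈ Complex.slitPlane ∧ (r : ℂ) - x ∈ Complex.slitPlane ∧
      1 - (r : ℂ) * x ∈ Complex.slitPlane := by
  refine ⟨?_, ?_, ?_⟩
  · rw [show (1 : ℂ) - (x : ℂ) ^ 2 = ((1 - x ^ 2 : ℝ) : ℂ) by push_cast; ring,
      Complex.ofReal_mem_slitPlane]
    nlinarith [hx.1, hx.2, hr.2]
  · rw [show (r : ℂ) - (x : ℂ) = ((r - x : ℝ) : ℂ) by push_cast; ring, Complex.ofReal_mem_slitPlane]
    linarith [hx.2]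
  · rw [show (1 : ℂ) - (r : ℂ) * (x : ℂ) = ((1 - r * x : ℝ) : ℂ) by push_cast; ring,
      Complex.ofReal_mem_slitPlane]
    nlinarith [hx.1, hx.2, hr.1, hr.2]

/-- **`L_r` has the boundary value `L_r x` at a floor point `x ∈ (-1, r)`.** [folklore] -/
theorem tendsto_Lfun_ofReal {r x : ℝ} (hr : 0 < r ∧ r < 1) (hx : -1 < x ∧ x < r) :
    Tendsto (Lfun r) (𝓝[HD] (x : ℂ)) (𝓝 (Lfun r x)) :=
  (continuousAt_Lfun (slit_ofReal hr hx).1 (slit_ofReal hr hx).2.1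
    (slit_ofReal hr hx).2.2).tendsto.mono_left nhdsWithin_le_nhds

/-! ## §5 The endgame at a floor point -/

/-- **Incompatibility of the two predicted ratio limits**: for `p ≠ q` in `(0,1)` and a floor
point `0 < x < min p q`, `exp((5/8)(l_q x - l_q 0)) ≠ exp((5/8)(l_p x - l_p 0))`
(it would force `x (p - q)(1 - p q) = 0`). [folklore] -/
theorem endgame_real {p q x : ℝ} (hp : 0 < p ∧ p < 1) (hq : 0 < q ∧ q < 1) (hpq : p ≠ q)
    (hx0 : 0 < x) (hxp : x < p) (hxq : x < q)
    (h : Complex.exp ((5 / 8 : ℂ) * ((lreal q x : ℂ) - (lreal q 0 : ℂ))) =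
      Complex.exp ((5 / 8 : ℂ) * ((lreal p x : ℂ) - (lreal p 0 : ℂ)))) : False := by
  -- both exponents are real, hence equal
  rw [show (5 / 8 : ℂ) * ((lreal q x : ℂ) - (lreal q 0 : ℂ)) = (((5 / 8) * (lreal q x - lreal q 0) : ℝ) : ℂ) by
      push_cast; ring,
    show (5 / 8 : ℂ) * ((lreal p x : ℂ) - (lreal p 0 : ℂ)) = (((5 / 8) * (lreal p x - lreal p 0) : ℝ) : ℂ) by
      push_cast; ring, Complex.exp_eq_exp_iff_exists_int] at h
  obtain ⟨n, hn⟩ := h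
  have hn0 : n = 0 := by
    have him := congrArg Complex.im hn
    simp only [Complex.ofReal_im, Complex.add_im, Complex.mul_im, Complex.intCast_re,
      Complex.intCast_im, Complex.mul_re, Complex.re_ofNat, Complex.ofReal_re, Complex.im_ofNat,
      Complex.ofReal_im, Complex.I_re, Complex.I_im, mul_zero, sub_zero, zero_mul, add_zero,
      mul_one, zero_add] at him
    have : (n : ℝ) * (2 * Real.pi) = 0 := by linarith
    rcases mul_eq_zero.1 this with h | h
    · exact_mod_cast h
    · exfalso; linarith [Real.pi_pos]
  rw [hn0] at hn
  simp only [Int.cast_zero, zero_mul, add_zero, Complex.ofReal_inj] at hn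
  have hab : lreal q x - lreal q 0 = lreal p x - lreal p 0 := by linarith
  -- unfold the real logarithms: `log(p-x) + log(1-px) - log p = log(q-x) + log(1-qx) - log q`
  have key : Real.log (p - x) + Real.log (1 - p * x) - Real.log p =
      Real.log (q - x) + Real.log (1 - q * x) - Real.log q := by
    unfold lreal at hab
    simp only [mul_zero, sub_zero, ne_eq, OfNat.ofNat_ne_zero, not_false_eq_true, zero_pow,
      Real.log_one, add_zero] at hab
    linarith
  have e : ∀ r : ℝ, 0 < r → 0 < r - x → 0 < 1 - r * x →
      Real.exp (Real.log (r - x) + Real.log (1 - r * x) - Real.log r) = (r - x) * (1 - r * x) / r := by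
    intro r h0 h3 h4
    rw [Real.exp_sub, Real.exp_add, Real.exp_log h3, Real.exp_log h4, Real.exp_log h0]
  have hp4 : 0 < 1 - p * x := by nlinarith
  have hq4 : 0 < 1 - q * x := by nlinarith
  have key2 : (p - x) * (1 - p * x) / p = (q - x) * (1 - q * x) / q := by
    rw [← e p hp.1 (by linarith) hp4, ← e q hq.1 (by linarith) hq4, key]
  rw [div_eq_div_iff hp.1.ne' hq.1.ne'] at key2
  have hz : x * ((p - q) * (1 - p * q)) = 0 := by linear_combination key2
  rcases mul_eq_zero.1 hz with h1 | h1
  · exact hx0.ne' h1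
  · rcases mul_eq_zero.1 h1 with h2 | h2
    · exact hpq (by linarith)
    · nlinarith [hp.1, hp.2, hq.1, hq.2]

end Summit.CriticalPhenomena.SAWScalingLimit.Theorems.ObservableToSLE.Negative

end
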